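import Literature.NumberTheory.LFunctions.Zhang2022.SkeletonPartOne
import Literature.NumberTheory.LFunctions.Zhang2022.Section3Lemma36
import HarnessLib

/-!
# Zhang (2022), skeleton node `Lemma36` DISCHARGED: Lemma 3.6 holds (DAG node `Z22:Lem3.6`)

Topic `Literature/NumberTheory/LFunctions/Zhang2022` (Landau–Siegel audit tree; verdict-neutral).
Y. Zhang, *Discrete mean estimates and the Landau–Siegel zero*, arXiv:2211.02515v1 (2022)
[Zhang2022LandauSiegel] — **an unrefereed manuscript under adjudication** — §3, Lemma 3.6
[Z22 p.16, tex L862] (D-0069 campaign DAG node `Z22:Lem3.6`, discharge row D12, cone C03):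

> **Lemma 3.6.** Assume that (A) holds. The inequality
> `|X₄(D⁸,ψ)| + ∫_{D⁴}^{D⁸} |X₄(x,ψ)| dx/x < 𝓛⁻⁶³³`  (3.6)
> holds for all but at most `O(𝔓𝓛⁻⁷³⁹)` characters `ψ` in `Ψ`.

The typed skeleton states this as the CLAIM `Skeleton.Lemma36` (`SkeletonPartOne`, a leaf of the
whole-DAG theorem `Skeleton.theorem1_of_leaves`). The tree already PROVES Lemma 3.6 under (A) alone,
uniformly over every finite set `M` of moduli exceeding `D⁸` (`Lemma36.lemma_3_6`,
`Section3Lemma36`; its analytic input `∑ ς(n)²/n ≪ 𝓛⁻²⁰⁰⁷` is the input-free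
`Lemma36Input.lemma_3_6_input'`). This file is the theorem-only BRIDGE from that tree theorem to the
skeleton's encoding, i.e. it closes the leaf:

* `nu_eq_ofReal_nuOf`, `ups_eq_ofReal_upsilonOf`, `sig_eq_ofReal_sigma36` — for a quadratic
  `χ` the skeleton's complex coefficient sequences `ν = 1 ∗ χ`, `υ = μ ∗ μχ`,
  `ς = (ν·1_{≤D⁴}) ∗ (υ·1_{≤D⁴})` (`Skeleton.nu/ups/sig`) are the real sequences
  `nuOf (reChar χ)`, `upsilonOf (reChar χ)`, `Lemma36.sigma36 χ` of `Section3SigmaSplitting` /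
  `Section3Lemma36`, cast to `ℂ`;
* `X4_eq_X4Sum`, `lhs36_eq` — `Skeleton.X4 χ x y = Lemma36.X4Sum χ s₀ ψ ⌊y⌋` and the left side of
  (3.6) in the skeleton (`Skeleton.Ineq36`) is `Lemma36.lhs36 χ s₀ ψ`;
* `eight_pow_lt_of_mem_primeWindow` — every `p ∼ P` exceeds `D⁸` once `𝓛 ≥ 3` (`P = exp 𝓛⁹`);
* **`lemma36_holds : Skeleton.Lemma36`** — the exceptional set `{ψ ∈ Ψ : ¬(3.6)}` embeds in
  `Σ_{p∼P} {ψ mod p primitive : lhs ≥ 𝓛⁻⁶³³}`, whose size `Lemma36.lemma_3_6` bounds by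
  `C𝔓𝓛⁻⁷³⁹` (`𝔓 = ∑_{p∼P} p`, `Skeleton.frakP_eq_sum_primeWindow`).

No new definitions, no new facts. WHAT THIS IS NOT: any statement about Theorems 1–2 of the
manuscript or about Landau–Siegel zeros; the cell verdict (gap at (8.24)) is untouched.

## References

* Y. Zhang, arXiv:2211.02515v1 (2022), §3 Lemma 3.6, p. 16. [cite: Zhang2022LandauSiegel, §3 Lemma 3.6]
-/

noncomputable section

open Complex Real Finset MeasureTheory ArithmeticFunction

namespace Literature.NumberTheory.LFunctions.Zhang2022.Skeleton

open Literature.NumberTheory.LFunctions.DirichletAbel (reChar ofReal_reChar)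

variable {D : ℕ} (χ : DirichletCharacter ℂ D)

/-! ## The skeleton's coefficient sequences are the tree's real sequences -/

/-- For quadratic `χ`, the skeleton's `ν = 1 ∗ χ` (`divisorSumChar χ`) is the tree's real
`nuOf (reChar χ)` cast to `ℂ` (`ν(n) = ∑_{d∣n} χ(d)` is real). [cite: Zhang2022LandauSiegel, §3 p. 6] -/
theorem nu_eq_ofReal_nuOf (hχ : χ ^ 2 = 1) (n : ℕ) :
    nu χ n = ((nuOf (reChar χ) n : ℝ) : ℂ) := by
  rw [Lemma36Input.nuOf_reChar_eq]
  have him := Lemma31.divisorSumChar_im_eq_zero χ hχ n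
  simp only [nu]
  exact Complex.ext (by simp) (by simp [him])

/-- For quadratic `χ`, the skeleton's `υ = μ ∗ μχ` is the tree's real `upsilonOf (reChar χ)` cast
to `ℂ`. [cite: Zhang2022LandauSiegel, §3 p. 6] -/
theorem ups_eq_ofReal_upsilonOf (hχ : χ ^ 2 = 1) (n : ℕ) :
    ups χ n = ((upsilonOf (reChar χ) n : ℝ) : ℂ) := by
  rw [ups, LSeries.convolution_def, upsilonOf, ArithmeticFunction.mul_apply]
  push_cast
  refine Finset.sum_congr rfl fun x hx => ?_
  have hx2 : x.2 ≠ 0 := (Nat.ne_zero_of_mem_divisorsAntidiagonal hx).2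
  rw [ArithmeticFunction.pmul_apply, ArithmeticFunction.intCoe_apply,
    ArithmeticFunction.intCoe_apply]
  push_cast
  rw [ofReal_reChar χ hχ hx2]

/-- For quadratic `χ`, the skeleton's `ς` (`Skeleton.sig χ`, the convolution of `ν·1_{n≤D⁴}` and
`υ·1_{n≤D⁴}`) is the tree's `sigmaTrunc (nuOf (reChar χ)) (upsilonOf (reChar χ)) D⁴`
(= `Lemma36.sigma36 χ`) cast to `ℂ`. [cite: Zhang2022LandauSiegel, §3 p. 7] -/
theorem sig_eq_ofReal_sigma36 (hχ : χ ^ 2 = 1) (n : ℕ) :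
    sig χ n = ((Lemma36.sigma36 χ n : ℝ) : ℂ) := by
  rw [sig, LSeries.convolution_def, Lemma36.sigma36, sigmaTrunc, Finset.sum_filter,
    Complex.ofReal_sum]
  refine Finset.sum_congr rfl fun x _ => ?_
  by_cases h : x.1 ≤ D ^ 4 ∧ x.2 ≤ D ^ 4
  · rw [if_pos h, trunc, trunc, if_pos h.1, if_pos h.2, Complex.ofReal_mul,
      nu_eq_ofReal_nuOf χ hχ, ups_eq_ofReal_upsilonOf χ hχ]
  · rw [if_neg h, Complex.ofReal_zero, trunc, trunc]
    rcases not_and_or.mp h with h1 | h2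
    · rw [if_neg h1, zero_mul]
    · rw [if_neg h2, mul_zero]

/-! ## `X₄` and the left side of (3.6) -/

/-- The skeleton's `X₄(y,ψ)` is the tree's `X4Sum` at the integer height `⌊y⌋` and `s = s₀`.
[cite: Zhang2022LandauSiegel, §3 p. 7] -/
theorem X4_eq_X4Sum (hχ : χ ^ 2 = 1) (x : Chr D) (y : ℝ) :
    X4 χ x y = Lemma36.X4Sum χ (s0 D) x.ψ ⌊y⌋₊ := by
  simp only [X4, Lemma36.X4Sum, Lemma36.twist36, sig_eq_ofReal_sigma36 χ hχ]

/-- The left side of (3.6) in the skeleton's encoding is the tree's `Lemma36.lhs36 χ s₀ ψ`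
(`⌊(D:ℝ)⁸⌋ = D⁸`; the integration limits `(D:ℝ)⁴, (D:ℝ)⁸` are the casts of `D⁴, D⁸`).
[cite: Zhang2022LandauSiegel, §3 (3.6)] -/
theorem lhs36_eq (hχ : χ ^ 2 = 1) (x : Chr D) :
    ‖X4 χ x ((D : ℝ) ^ 8)‖ + ∫ y in (D : ℝ) ^ 4..(D : ℝ) ^ 8, ‖X4 χ x y‖ / y =
      Lemma36.lhs36 χ (s0 D) x.ψ := by
  have h8 : ⌊(D : ℝ) ^ 8⌋₊ = D ^ 8 := by rw [← Nat.cast_pow, Nat.floor_natCast]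
  simp only [Lemma36.lhs36, X4_eq_X4Sum χ hχ, h8, Nat.cast_pow]

/-- Hence (3.6) in the skeleton (`Skeleton.Ineq36 χ x`) says `lhs36 χ s₀ ψ < 𝓛⁻⁶³³`.
[cite: Zhang2022LandauSiegel, §3 (3.6)] -/
theorem ineq36_iff (hχ : χ ^ 2 = 1) (x : Chr D) :
    Ineq36 χ x ↔ Lemma36.lhs36 χ (s0 D) x.ψ < (ell D ^ 633)⁻¹ := by
  rw [Ineq36, lhs36_eq χ hχ]

/-! ## Sizes: `𝓛 ≥ 3` and `p ∼ P ⇒ p > D⁸` -/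

/-- `log D ≥ 3` once `D ≥ ⌈e³⌉`. [folklore] -/
private theorem three_le_log_of_le (hD : ⌈Real.exp 3⌉₊ ≤ D) : 3 ≤ Real.log D := by
  have h : Real.exp 3 ≤ D := le_trans (Nat.le_ceil _) (by exact_mod_cast hD)
  exact (Real.le_log_iff_exp_le (lt_of_lt_of_le (Real.exp_pos _) h)).mpr h

/-- Every modulus of the window `p ∼ P` (`P < p`, `P = exp 𝓛⁹`) exceeds `D⁸ = exp(8𝓛)` once
`𝓛 = log D ≥ 3` (`8𝓛 ≤ 3⁸𝓛 ≤ 𝓛⁹`). [cite: Zhang2022LandauSiegel, §2 (2.6)] -/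
theorem eight_pow_lt_of_mem_primeWindow (hlog : 3 ≤ Real.log D) {p : ℕ} (hp : p ∈ primeWindow D) :
    D ^ 8 < p := by
  have hD0 : (0 : ℝ) < D := by
    rcases Nat.eq_zero_or_pos D with h | h
    · subst h; norm_num [Real.log_zero] at hlog
    · exact_mod_cast h
  simp only [primeWindow, Finset.mem_filter, Finset.mem_Ioo] at hp
  have hPp : bigP D < p := Nat.lt_of_floor_lt hp.1.1
  have h8 : ((D ^ 8 : ℕ) : ℝ) ≤ bigP D := by
    rw [Nat.cast_pow, bigP, ell]
    have hD8 : (D : ℝ) ^ 8 = Real.exp (8 * Real.log D) := by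
      rw [← Real.exp_log hD0, ← Real.exp_nat_mul, Real.log_exp]; norm_num
    rw [hD8, Real.exp_le_exp]
    have h38 : (3 : ℝ) ^ 8 ≤ Real.log D ^ 8 := pow_le_pow_left₀ (by norm_num) hlog 8
    nlinarith [h38]
  exact_mod_cast h8.trans_lt hPp

/-! ## The discharge -/

/-- **Lemma 3.6 of the manuscript HOLDS** (skeleton node `Skeleton.Lemma36`, DAG node
`Z22:Lem3.6` [Z22 p.16, tex L862], a leaf of `Skeleton.theorem1_of_leaves`): under (A), the
inequality (3.6) fails for at most `C𝔓𝓛⁻⁷³⁹` characters `ψ ∈ Ψ`, `D` large. Proof: the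
exceptional set `{ψ ∈ Ψ : ¬(3.6)}` embeds (by `ψ ↦ ⟨p, ψ⟩`) in
`Σ_{p∼P} {ψ mod p primitive : lhs36 ≥ 𝓛⁻⁶³³}`, whose cardinality the tree's `Lemma36.lemma_3_6`
(Lemma 3.6 under (A) alone — orthogonality, Cauchy–Schwarz in `dx/x`, Chebyshev, and the
input-free bound `∑ ς²/n ≪ 𝓛⁻²⁰⁰⁷`) bounds by `C(∑_{p∼P} p)𝓛⁻⁷³⁹ = C𝔓𝓛⁻⁷³⁹`, for `𝓛 ≥ 3` (so
that every `p ∼ P` exceeds `D⁸`). [cite: Zhang2022LandauSiegel, §3 Lemma 3.6] -/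
theorem lemma36_holds : Lemma36 := by
  classical
  obtain ⟨C, hC⟩ := Lemma36.lemma_3_6
  refine ⟨C, ⌈Real.exp 3⌉₊, fun D _ χ hD hq hp hA => ?_⟩
  have hlog : 3 ≤ Real.log D := three_le_log_of_le hD
  have hχ2 : χ ^ 2 = 1 := hq.sq_eq_one
  have hA' : ‖χ.LFunction 1‖ ≤ 1 / Real.log D ^ 2022 := le_of_lt hA
  have hs0 : (s0 D).re = 1 / 2 := by simp [s0, SmoothWeight.s0]
  have hM : ∀ p ∈ primeWindow D, D ^ 8 < p := fun p hp' =>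
    eight_pow_lt_of_mem_primeWindow hlog hp'
  obtain ⟨-, hcount⟩ := hC D χ hp hχ2 hlog hA' (s0 D) hs0 (primeWindow D) hM
  -- the target finite set `Σ_{p ∼ P} {ψ mod p primitive with lhs ≥ 𝓛⁻⁶³³}`
  set T : Finset ((p : ℕ) × DirichletCharacter ℂ p) := (primeWindow D).sigma fun p =>
    Finset.univ.filter fun ψ : DirichletCharacter ℂ p =>
      ψ.IsPrimitive ∧ 1 / Real.log D ^ 633 ≤ Lemma36.lhs36 χ (s0 D) ψ with hTdef
  have hcard : {x : Chr D | ¬ Ineq36 χ x}.ncard ≤ T.card := by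
    rw [← Set.ncard_coe_finset]
    refine Set.ncard_le_ncard_of_injOn
      (fun x : Chr D => (⟨x.p, x.ψ⟩ : (p : ℕ) × DirichletCharacter ℂ p)) ?_ ?_
      (Finset.finite_toSet T)
    · intro x hx
      rw [Set.mem_setOf_eq, ineq36_iff χ hχ2, not_lt, ell, ← one_div] at hx
      rw [Finset.mem_coe, hTdef, Finset.mem_sigma, Finset.mem_filter]
      exact ⟨x.mem, Finset.mem_univ _, x.prim, hx⟩
    · rintro ⟨p, hp', ψ, hψ⟩ _ ⟨p', hp'', ψ', hψ'⟩ _ h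
      simp only [Sigma.mk.injEq] at h
      obtain ⟨rfl, h2⟩ := h
      simp only [heq_eq_eq] at h2
      subst h2
      rfl
  have hT : (T.card : ℝ) = ∑ p ∈ primeWindow D, ((Finset.univ.filter
      fun ψ : DirichletCharacter ℂ p =>
        ψ.IsPrimitive ∧ 1 / Real.log D ^ 633 ≤ Lemma36.lhs36 χ (s0 D) ψ).card : ℝ) := by
    rw [hTdef, Finset.card_sigma]; push_cast; rfl
  calc (({x : Chr D | ¬ Ineq36 χ x}.ncard : ℕ) : ℝ) ≤ T.card := by exact_mod_cast hcard
    _ = _ := hT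
    _ ≤ C * (∑ p ∈ primeWindow D, (p : ℝ)) / Real.log D ^ 739 := hcount
    _ = C * frakP D * (ell D ^ 739)⁻¹ := by
        rw [frakP_eq_sum_primeWindow, ell, div_eq_mul_inv]

/-- `Lemma36` — `_holds` alias of `lemma36_holds` above under the fact's exact name (appended
2026-08-28, D-0026 bookkeeping: the proof term is the existing theorem of this file; no statement,
definition or attribute is edited; no new named fact; the ledger's debt table listed the fact
unproved). [cite: Zhang2022LandauSiegel, §3 Lemma 3.6] -/
theorem _root_.Literature.NumberTheory.LFunctions.Zhang2022.Skeleton.Lemma36_holds : Lemma36 :=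
  _root_.Literature.NumberTheory.LFunctions.Zhang2022.Skeleton.lemma36_holds

end Literature.NumberTheory.LFunctions.Zhang2022.Skeleton

end
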